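import Summits.Ventures.PercRepro.S1TriangleCount

/-!
# PercRepro — the s₄ recursion on the (C1)+(C2)+(C3)+hfree core, CONDITIONAL on the per-point bound (p1, gen 20)

If every core `N` ((C1) lines ≤ 3, (C2) planes ≤ 6, (C3) solids ≤ 10, `hfree` at every point) has at most `3ν`
four-circuits through each point (`hpp`), then `2·s₄ ≤ 3ν(ν + 1)` on every core: delete a point `e` of a 4-circuit — `M ＼ {e}` is again
e-free (`hfree_delete`), has nullity `ν − 1`, and the 4-circuits avoiding `e` are its 4-circuits.
The seat's remaining work is `hpp` itself.
Axioms: standard.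
-/

open scoped Matroid

namespace PercRepro

namespace S1

open Set

variable {α : Type}

/-- `hfree` at every point survives the deletion of a point. -/
theorem hfree_delete' (M : Matroid α)
    (hfree : ∀ e ∈ M.E, ∃ A ⊆ M.E \ {e}, e ∉ M.closure A ∧ e ∉ M.closure ((M.E \ {e}) \ A)) (x : α) :
    ∀ e ∈ (M ＼ {x}).E, ∃ A ⊆ (M ＼ {x}).E \ {e},
      e ∉ (M ＼ {x}).closure A ∧ e ∉ (M ＼ {x}).closure (((M ＼ {x}).E \ {e}) \ A) := by
  intro e he
  rw [_root_.Matroid.delete_ground] at he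
  obtain ⟨A, hA, h1, h2⟩ := hfree e he.1
  refine ⟨A \ {x}, ?_, ?_, ?_⟩
  · rw [_root_.Matroid.delete_ground]
    intro z hz
    have := hA hz.1
    exact ⟨⟨this.1, hz.2⟩, this.2⟩
  · rw [_root_.Matroid.delete_closure_eq]
    intro h
    exact h1 (M.closure_subset_closure (sdiff_subset.trans sdiff_subset) h.1)
  · rw [_root_.Matroid.delete_closure_eq, _root_.Matroid.delete_ground]
    intro h
    refine h2 (M.closure_subset_closure ?_ h.1)
    intro z hz
    obtain ⟨⟨⟨⟨hzE, hzx⟩, hze⟩, hzA⟩, _⟩ := hz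
    exact ⟨⟨hzE, hze⟩, fun hzA' => hzA ⟨hzA', hzx⟩⟩

/-- A bound «every set of rank `≤ k` has `≤ m` points» survives deleting a point. -/
theorem flat_bound_le_delete' (M : Matroid α) {k : ℕ∞} {m : ℕ}
    (hC : ∀ P ⊆ M.E, M.eRk P ≤ k → P.ncard ≤ m) (e : α) :
    ∀ P ⊆ (M ＼ {e}).E, (M ＼ {e}).eRk P ≤ k → P.ncard ≤ m := by
  intro P hP hr
  rw [_root_.Matroid.delete_ground] at hP
  rw [delete_singleton_eRk_eq hP] at hr
  exact hC P (hP.trans sdiff_subset) hr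

/-- A bound «every set of rank `= k` has `≤ m` points» survives deleting a point. -/
theorem flat_bound_eq_delete' (M : Matroid α) {k : ℕ∞} {m : ℕ}
    (hC : ∀ P ⊆ M.E, M.eRk P = k → P.ncard ≤ m) (e : α) :
    ∀ P ⊆ (M ＼ {e}).E, (M ＼ {e}).eRk P = k → P.ncard ≤ m := by
  intro P hP hr
  rw [_root_.Matroid.delete_ground] at hP
  rw [delete_singleton_eRk_eq hP] at hr
  exact hC P (hP.trans sdiff_subset) hr

/-- **The s₄ recursion** (conditional on the per-point bound `hpp`): `2·s₄ ≤ 3ν(ν + 1)` on every e-free core. -/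
theorem two_mul_ncard_fourCircuits_le_of_perpoint
    (hpp : ∀ (N : Matroid α) [N.Finite],
      (∀ L ⊆ N.E, N.eRk L = 2 → L.ncard ≤ 3) → (∀ P ⊆ N.E, N.eRk P ≤ 3 → P.ncard ≤ 6) →
      (∀ Q ⊆ N.E, N.eRk Q ≤ 4 → Q.ncard ≤ 10) →
      (∀ e ∈ N.E, ∃ A ⊆ N.E \ {e}, e ∉ N.closure A ∧ e ∉ N.closure ((N.E \ {e}) \ A)) →
      ∀ d : ℕ, N.E.encard = N.eRank + d →
      ∀ e ∈ N.E, {C : Set α | N.IsCircuit C ∧ C.ncard = 4 ∧ e ∈ C}.ncard ≤ 3 * d)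
    (M : Matroid α) [M.Finite]
    (hC1 : ∀ L ⊆ M.E, M.eRk L = 2 → L.ncard ≤ 3) (hC2 : ∀ P ⊆ M.E, M.eRk P ≤ 3 → P.ncard ≤ 6)
    (hC3 : ∀ Q ⊆ M.E, M.eRk Q ≤ 4 → Q.ncard ≤ 10)
    (hfree : ∀ e ∈ M.E, ∃ A ⊆ M.E \ {e}, e ∉ M.closure A ∧ e ∉ M.closure ((M.E \ {e}) \ A))
    {d : ℕ} (hd : M.E.encard = M.eRank + d) :
    2 * {C : Set α | M.IsCircuit C ∧ C.ncard = 4}.ncard ≤ 3 * d * (d + 1) := by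
  suffices H : ∀ n : ℕ, ∀ (M : Matroid α) [M.Finite], M.E.ncard = n →
      (∀ L ⊆ M.E, M.eRk L = 2 → L.ncard ≤ 3) → (∀ P ⊆ M.E, M.eRk P ≤ 3 → P.ncard ≤ 6) →
      (∀ Q ⊆ M.E, M.eRk Q ≤ 4 → Q.ncard ≤ 10) →
      (∀ e ∈ M.E, ∃ A ⊆ M.E \ {e}, e ∉ M.closure A ∧ e ∉ M.closure ((M.E \ {e}) \ A)) →
      ∀ d : ℕ, M.E.encard = M.eRank + d →
      2 * {C : Set α | M.IsCircuit C ∧ C.ncard = 4}.ncard ≤ 3 * d * (d + 1) from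
    H _ M rfl hC1 hC2 hC3 hfree d hd
  intro n
  induction n using Nat.strong_induction_on with
  | _ n ih =>
  intro M _ hn hC1 hC2 hC3 hfree d hd
  classical
  set S := {C : Set α | M.IsCircuit C ∧ C.ncard = 4} with hS
  have hSfin : S.Finite :=
    M.ground_finite.finite_subsets.subset (fun C hC => hC.1.subset_ground)
  by_cases hSe : S = ∅
  · rw [hSe, ncard_empty]; omega
  obtain ⟨C₀, hC₀⟩ := nonempty_iff_ne_empty.2 hSe
  obtain ⟨e, heC₀⟩ := hC₀.1.nonempty
  have heE : e ∈ M.E := hC₀.1.subset_ground heC₀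
  set S₁ := {C : Set α | M.IsCircuit C ∧ C.ncard = 4 ∧ e ∈ C} with hS₁
  set S₂ := {C : Set α | (M ＼ {e}).IsCircuit C ∧ C.ncard = 4} with hS₂
  have hS₁fin : S₁.Finite := hSfin.subset (fun C hC => ⟨hC.1, hC.2.1⟩)
  have hS₂fin : S₂.Finite :=
    (M ＼ {e}).ground_finite.finite_subsets.subset (fun C hC => hC.1.subset_ground)
  have hsplit : S ⊆ S₁ ∪ S₂ := by
    intro C hC
    by_cases h : e ∈ C
    · exact Or.inl ⟨hC.1, hC.2, h⟩
    · exact Or.inr ⟨_root_.Matroid.delete_isCircuit_iff.2 ⟨hC.1, disjoint_singleton_right.2 h⟩, hC.2⟩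
  have h3 : S.ncard ≤ S₁.ncard + S₂.ncard := by
    calc S.ncard ≤ (S₁ ∪ S₂).ncard := ncard_le_ncard hsplit (hS₁fin.union hS₂fin)
      _ ≤ S₁.ncard + S₂.ncard := ncard_union_le _ _
  have h1 : S₁.ncard ≤ 3 * d := hpp M hC1 hC2 hC3 hfree d hd e heE
  have hne : ¬ M.IsColoop e := hC₀.1.not_isColoop_of_mem heC₀
  have hν : M✶.eRank = (d : ℕ∞) := by
    have h := _root_.Matroid.eRank_add_eRank_dual M
    rw [hd] at h
    exact WithTop.add_left_cancel (PercRepro.Matroid.eRank_ne_top_of_finite M) h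
  have hdel := PercRepro.Matroid.dual_eRank_delete_singleton_add_one heE hne
  rw [hν] at hdel
  have hfin' : (M ＼ {e})✶.eRank ≠ ⊤ := by
    intro h
    rw [h] at hdel
    exact absurd hdel (by simp)
  obtain ⟨d', hd'⟩ := ENat.ne_top_iff_exists.1 hfin'
  have hdd' : d = d' + 1 := by
    rw [← hd'] at hdel
    exact_mod_cast hdel.symm
  have hd'enc : (M ＼ {e}).E.encard = (M ＼ {e}).eRank + d' := by
    have h := _root_.Matroid.eRank_add_eRank_dual (M ＼ {e})
    rw [← hd'] at h
    exact h.symm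
  have hdelE : (M ＼ {e}).E.ncard < n := by
    rw [_root_.Matroid.delete_ground, ← hn, ← ncard_sdiff_singleton_add_one heE M.ground_finite]
    omega
  have h2 : 2 * S₂.ncard ≤ 3 * d' * (d' + 1) :=
    ih _ hdelE (M ＼ {e}) rfl (flat_bound_eq_delete' M hC1 e) (flat_bound_le_delete' M hC2 e)
      (flat_bound_le_delete' M hC3 e) (hfree_delete' M hfree e) d' hd'enc
  subst hdd'
  nlinarith [h1, h2, h3]

end S1

end PercRepro
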